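import Literature.MathematicalPhysics.QuantumFieldTheory.Balaban1983to89.B3Ineq25Op116Smooth

/-!
# Bałaban, *(Higgs)₂,₃ quantum fields in a finite volume III. Renormalization* [B3] — inequality (2.5) p. 424, the (1.16) alternative, with
print's smooth localization functions: THE ASSEMBLY FROM KERNEL ENTRIES AT THE INTERIOR POINTS OF THE LOCALIZATION REGION `Ω₂` ONLY
(inner-`Good` form of `B3Ineq25Op116Smooth.ineq25At_op116_smooth_of_bounds`; file «Ineq25Op116SmoothInner» of the cell's Route δ for class (c), p. 433)

statement-level skeleton of published theorems with citation tags; proofs where landed; nothing here is a claim about the Yang–Mills mass gap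

T. Bałaban, Commun. Math. Phys. **88** (1983) 411–445 [cite: Balaban1983Higgs3]; part I, Commun. Math. Phys. **85** (1982) 603–636
[cite: Balaban1982Higgs1].  PDF held: `paper:balaban1983-higgs-2-3-quantum-fields-finite-volume` (journal page = PDF page + 410; p. 414 =
`p0004.txt`, p. 420 = `p0010.txt`, p. 424 = `p0014.txt`, p. 433 = `p0023.txt`).

CITATION HEADER (lean-in-tree rule).  Cell `lit-balaban` (HOME `run/shared/lean/pub/lit-balaban/`), Phase-2 proof seat **p40** gen 77
(unit `lit-balaban-p40`, literature-prover-lit-balaban-p40-g77-0); free-target protocol G.5-34(d), TAKING line HOME/STATUS.md 2026-08-23T12:41:06Z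
(cc r15 = fold owner of rows B3.Txt@433 / B3.Prop1 / B3.Eq1.16 / B3.Eq2.5, p35, r14, p33); design note `lit-balaban-p40/DESIGN-B3-116-box.md` v3
§5/§5.1 (Route δ; FILE 2 «assembly via `normM2_le_of_entries` with `Good := Interior k K₀ Ω₂`»).  LOCATED VARIANT of p40 g72's assembly theorem
(`B3Ineq25Op116Smooth`, rows B3.Eq2.5 / B3.Eq1.16, owner r15) — no head claim.  USED BY NAME: p40's `B3Ineq25Op116Smooth.{sect2Smooth116,
ineq25At_smooth116_iff, ineq25_delta_iff, normHGH116S, siteInner_op116_adj}`, p40 g71's `B3Norm132TwoFamilyMultiplier.{normM2_le_of_entries,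
DomG.of_domD}`, p33's `B3Ineq25SmoothLocalization.{sect2DeltaSmooth, SmoothLocFn, setDist, pow_mul_setDist_le}`, p40's smooth class
`B3Ineq31SmoothLocalization.smoothConst`.

## What is printed, and why this variant

[B3] p. 424 (2.5) and p. 414 (1.16) as quoted in `B3Ineq25Op116Smooth`; p. 420: the localization functions are supported in admissible domains
of unit cubes.  The (1.32) norm `‖h T h′‖_{1,α}` reads the kernel of `T` only at points of `supp h × supp h′`; p33's admissible domains
(`DomD k K₀ Ω₂ r₀ m`) consist of INTERIOR points of the localization region `Ω₂` (`DomG.of_domD`).  p40 g72's theorem asked for the eight entry-binders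
at all interior points of the propagator region `Ω ⊇ Ω₂` (convenient for the torus and for p. 412's deep-support regime, where the entries are uniformly
bounded on all of `Ω`); the collar operator `G_k(□,Y)V_k(P,Y)G_k(□,Y+P)` of the cell's recorded Route δ for the class-(c) sentence of p. 433 (*"we
expand in B̃′ … include the operators (1.16) … into the external fields"*) has small entries ONLY far from `supp P`, i.e. at the interior points of
the central region `Ω₂`, not on all of `□`.  Hence this variant: the same conclusion from binders guarded by `Interior k K₀ Ω₂`, and no inclusion
hypothesis.

## What this file proves

`ineq25At_op116_smooth_of_bounds_inner`: p40 g72's `ineq25At_op116_smooth_of_bounds` with every guard `Interior k K₀ Ω` replaced by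
`Interior k K₀ Ω₂` and the hypothesis `Ω₂ ⊆ Ω` dropped — same proof, `Good := Interior k K₀ Ω₂`, `hdom := DomG.of_domD f.dom`.  (The old
theorem is the special case obtained by weakening the binders along `Interior.mono`.)

## Honest scope

As in `B3Ineq25Op116Smooth`: the kernel entries and p33's `δG_k` clause are HYPOTHESES; `e_R`, `p_R` carrier parameters; constants as displayed.
Theorems only (one private helper re-declared): no `def`, no `def … : Prop`, no new named fact, no `sorry`; axioms standard.  The class-(c) use is
a RECORDED ROUTE DEVIATION from p. 433 l.12–15 (print's one-piece expansion on `□` is the cell's located open gap G-B3-16.A1).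
-/

noncomputable section

open scoped BigOperators InnerProductSpace Matrix

namespace Literature.MathematicalPhysics.QuantumFieldTheory.Balaban1983to89.B3Ineq25Op116SmoothInner

open HiggsLattice (ChargeData ScalarField siteInner covDeriv)
open HiggsCovariance (propagatorK E)
open B1Eq230FluctCov (Ix cb)
open B1TorusChainTransport (hol)
open B3Sect2StatementsPart2 (ScaledKernels)
open B3Ineq210RegularRegion (Interior)
open B3Ineq211RegularTorus (IsAdm)
open B3Ineq210MixedRegularTorus (onb dip)
open B3Ineq31RegularTorus (two_lt_sitesPerDir)
open B3Ineq31SmoothLocalization (smoothConst smoothConst_pos)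
open B3Ineq25SmoothLocalization (DomD setDist setDist_nonneg pow_mul_setDist_le SmoothLocFn sect2DeltaSmooth normHGHDS)
open B3Norm132TwoFamilyMultiplier (normM2_le_of_entries DomG)
open B3Eq116TwoSidedExpansion (op116)
open B3Ineq25Op116Smooth (sect2Smooth116 ineq25At_smooth116_iff ineq25_delta_iff normHGH116S siteInner_op116_adj)

variable {P : HiggsLattice.Params} {N : ℕ}

section Main

variable {k K₀ r₀ m : ℕ} {hL1 : 1 < P.L} {C : ChargeData N} {Ω Ω₂ : Finset (HiggsLattice.Site P 0)} {A B : HiggsLattice.VecField P 0}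
  {msq a : ℝ} {c₁ c₂ eR pR : ℝ}

/-- weakening a decay rate. [folklore] -/
private theorem exp_rate_mono {δ δ' t : ℝ} (h : δ ≤ δ') (ht : 0 ≤ t) : Real.exp (-(δ' * t)) ≤ Real.exp (-(δ * t)) := by
  rw [Real.exp_le_exp]; nlinarith

set_option maxHeartbeats 800000 in
/-- **INEQUALITY (2.5) OF [B3] AT FIXED ORDERS `(n, n′)` — BOTH ALTERNATIVES — WITH PRINT'S SMOOTH LOCALIZATION FUNCTIONS, FROM THE KERNEL ENTRIES OF
THE OPERATOR (1.16) AT THE INTERIOR POINTS OF THE LOCALIZATION REGION `Ω₂` ONLY** (the inner-`Good` form of p40 g72's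
`B3Ineq25Op116Smooth.ineq25At_op116_smooth_of_bounds`: the (1.32) norm reads the kernel entries only at points of the admissible domains, which are
interior points of `Ω₂` — `B3Norm132TwoFamilyMultiplier.DomG.of_domD` — so the eight entry-binders are required at `Interior k K₀ Ω₂` points and NO
inclusion `Ω₂ ⊆ Ω` is needed; this is the form the collar operator of the cell's Route δ needs, whose entries are small only far from `supp P`).
Regions `Ω, Ω₂ ⊆ T_ε`, `1 ≤ k ≤ K`, `L ≥ 2`, `0 ≤ α ≤ 1`, bump constants `c₁, c₂ ≥ 0`, `e_Rp_R ≥ 0`.  GIVEN (i) the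
`δG_k(Ω,Ω₂,B̃)` clause on p33 g61's carrier at `(δ_G, C_G)`, `C_G ≥ 0` (p33's `ineq25_smooth_regularNested`, hypothesis-free, at the plug), and (ii) the
four kernel entries — value, row derivative, transported Hölder difference of the row derivative (admissible contours), mixed `D_xTD^*_{x′}` — of
`T = (1.16)_{n,n′}` AND of `T′ = (1.16)_{n′,n}` at interior points of `Ω₂`, rate `δ ≥ 0`, constants `C_V, C_D, C_H, C_M ≥ 0` times `(e_Rp_R)^{n+n′}`, in
p33's currency (print: *"the Hölder norms of the covariant derivatives of this kernel … are exponentially decaying with the distance of the arguments and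
are uniformly bounded by O(1)(e(L^kε)^{1−α})^{n+n′}"*, p. 414) — THEN
`(sect2Smooth116 …).Ineq25At n n′ α (min δ_G δ) (C_G + K(c₁,c₂+2c₁,d,m)(C_V+C_D) + C_H + dmC_M)`, i.e. clause (i) AND
`‖h(1.16)_{n,n′}h′‖_{1,α} ≤ C·(e_Rp_R)^{n+n′}·e^{−δ₀dist(supp h,supp h′)}` for ALL pairs of smooth localization functions of the carrier.
[cite: Balaban1983Higgs3, (2.5) p.424, (1.16) p.414, (1.32) p.420, p.433] [cite: Balaban1982Higgs1, Prop. 2.1 p.610] -/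
theorem ineq25At_op116_smooth_of_bounds_inner (hL2 : 2 ≤ P.L) (hk1 : 1 ≤ k) (hkK : k ≤ P.K) (n n' : ℕ)
    {α δG CG δ CV CD CH CM : ℝ} (hα0 : 0 ≤ α) (hα1 : α ≤ 1) (hc₁ : 0 ≤ c₁) (hc₂ : 0 ≤ c₂) (ht : 0 ≤ eR * pR)
    (hCG : 0 ≤ CG) (hδ : 0 ≤ δ) (hCV : 0 ≤ CV) (hCD : 0 ≤ CD) (hCH : 0 ≤ CH) (hCM : 0 ≤ CM)
    (hδG : (sect2DeltaSmooth hL1 C Ω Ω₂ B msq a k K₀ r₀ m c₁ c₂).Ineq25 α δG CG)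
    (hV : ∀ (x x' : HiggsLattice.Site P 0), Interior k K₀ Ω₂ x → Interior k K₀ Ω₂ x' →
      (P.mesh 0 ^ P.d)⁻¹ * ∑ i' : Ix N, ‖op116 C Ω A B msq a k n n' (cb P N 0 (x', i')) x‖
        ≤ CV * (eR * pR) ^ (n + n') * (P.mesh k ^ 2 * (P.mesh k ^ P.d)⁻¹) *
          Real.exp (-(δ * ((HiggsLattice.Site.tdist x x' : ℝ) / (P.L : ℝ) ^ k))))
    (hV' : ∀ (x x' : HiggsLattice.Site P 0), Interior k K₀ Ω₂ x → Interior k K₀ Ω₂ x' →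
      (P.mesh 0 ^ P.d)⁻¹ * ∑ i' : Ix N, ‖op116 C Ω A B msq a k n' n (cb P N 0 (x', i')) x‖
        ≤ CV * (eR * pR) ^ (n + n') * (P.mesh k ^ 2 * (P.mesh k ^ P.d)⁻¹) *
          Real.exp (-(δ * ((HiggsLattice.Site.tdist x x' : ℝ) / (P.L : ℝ) ^ k))))
    (hDv : ∀ (μ : Fin P.d) (x x' : HiggsLattice.Site P 0), Interior k K₀ Ω₂ x → Interior k K₀ Ω₂ x' →
      (P.mesh 0 ^ P.d)⁻¹ * ∑ i' : Ix N, ‖covDeriv C B (op116 C Ω A B msq a k n n' (cb P N 0 (x', i'))) ⟨x, μ⟩‖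
        ≤ CD * (eR * pR) ^ (n + n') * (P.mesh k * (P.mesh k ^ P.d)⁻¹) *
          Real.exp (-(δ * ((HiggsLattice.Site.tdist x x' : ℝ) / (P.L : ℝ) ^ k))))
    (hDv' : ∀ (μ : Fin P.d) (x x' : HiggsLattice.Site P 0), Interior k K₀ Ω₂ x → Interior k K₀ Ω₂ x' →
      (P.mesh 0 ^ P.d)⁻¹ * ∑ i' : Ix N, ‖covDeriv C B (op116 C Ω A B msq a k n' n (cb P N 0 (x', i'))) ⟨x, μ⟩‖
        ≤ CD * (eR * pR) ^ (n + n') * (P.mesh k * (P.mesh k ^ P.d)⁻¹) *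
          Real.exp (-(δ * ((HiggsLattice.Site.tdist x x' : ℝ) / (P.L : ℝ) ^ k))))
    (hH : ∀ (μ : Fin P.d) (x₁ x₂ x' : HiggsLattice.Site P 0) (Γ : List (HiggsLattice.Site P 0)),
      Interior k K₀ Ω₂ x₁ → Interior k K₀ Ω₂ x₂ → Interior k K₀ Ω₂ x' → x₁ ≠ x₂ → IsAdm x₁ x₂ Γ →
      (P.mesh 0 ^ P.d)⁻¹ * ∑ i' : Ix N, ‖hol C B x₁ Γ (covDeriv C B (op116 C Ω A B msq a k n n' (cb P N 0 (x', i'))) ⟨x₂, μ⟩)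
          - covDeriv C B (op116 C Ω A B msq a k n n' (cb P N 0 (x', i'))) ⟨x₁, μ⟩‖
        ≤ (P.mesh 0 * (HiggsLattice.Site.tdist x₁ x₂ : ℝ)) ^ α *
          (CH * (eR * pR) ^ (n + n') * (P.mesh k * (P.mesh k ^ P.d)⁻¹ * (P.mesh k ^ α)⁻¹)) *
          Real.exp (-(δ * (min (HiggsLattice.Site.tdist x₁ x' : ℝ) (HiggsLattice.Site.tdist x₂ x' : ℝ) / (P.L : ℝ) ^ k))))
    (hH' : ∀ (μ : Fin P.d) (x₁ x₂ x' : HiggsLattice.Site P 0) (Γ : List (HiggsLattice.Site P 0)),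
      Interior k K₀ Ω₂ x₁ → Interior k K₀ Ω₂ x₂ → Interior k K₀ Ω₂ x' → x₁ ≠ x₂ → IsAdm x₁ x₂ Γ →
      (P.mesh 0 ^ P.d)⁻¹ * ∑ i' : Ix N, ‖hol C B x₁ Γ (covDeriv C B (op116 C Ω A B msq a k n' n (cb P N 0 (x', i'))) ⟨x₂, μ⟩)
          - covDeriv C B (op116 C Ω A B msq a k n' n (cb P N 0 (x', i'))) ⟨x₁, μ⟩‖
        ≤ (P.mesh 0 * (HiggsLattice.Site.tdist x₁ x₂ : ℝ)) ^ α *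
          (CH * (eR * pR) ^ (n + n') * (P.mesh k * (P.mesh k ^ P.d)⁻¹ * (P.mesh k ^ α)⁻¹)) *
          Real.exp (-(δ * (min (HiggsLattice.Site.tdist x₁ x' : ℝ) (HiggsLattice.Site.tdist x₂ x' : ℝ) / (P.L : ℝ) ^ k))))
    (hM : ∀ (μ ν : Fin P.d) (x x' : HiggsLattice.Site P 0), Interior k K₀ Ω₂ x → Interior k K₀ Ω₂ x' →
      (P.mesh 0 ^ P.d)⁻¹ * ((P.mesh 0)⁻¹ *
          ∑ i : Ix N, ‖covDeriv C B (op116 C Ω A B msq a k n n' (dip C B ⟨x', ν⟩ (onb N i))) ⟨x, μ⟩‖)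
        ≤ CM * (eR * pR) ^ (n + n') * (P.mesh k ^ P.d)⁻¹ *
          Real.exp (-(δ * ((HiggsLattice.Site.tdist x x' : ℝ) / (P.L : ℝ) ^ k))))
    (hM' : ∀ (μ ν : Fin P.d) (x x' : HiggsLattice.Site P 0), Interior k K₀ Ω₂ x → Interior k K₀ Ω₂ x' →
      (P.mesh 0 ^ P.d)⁻¹ * ((P.mesh 0)⁻¹ *
          ∑ i : Ix N, ‖covDeriv C B (op116 C Ω A B msq a k n' n (dip C B ⟨x', ν⟩ (onb N i))) ⟨x, μ⟩‖)
        ≤ CM * (eR * pR) ^ (n + n') * (P.mesh k ^ P.d)⁻¹ *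
          Real.exp (-(δ * ((HiggsLattice.Site.tdist x x' : ℝ) / (P.L : ℝ) ^ k)))) :
    (sect2Smooth116 hL1 C Ω Ω₂ A B msq a k K₀ r₀ m c₁ c₂ eR pR).Ineq25At n n' α (min δG δ)
      (CG + (smoothConst P.d m c₁ (c₂ + 2 * c₁) * (CV + CD) + (CH + P.d * m * CM))) := by
  have hS : ∀ μ, 2 < P.sitesPerDir 0 μ := two_lt_sitesPerDir (hk1.trans hkK) hL2
  set t : ℝ := (eR * pR) ^ (n + n') with htdef
  have ht0 : 0 ≤ t := pow_nonneg ht _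
  set C116 : ℝ := smoothConst P.d m c₁ (c₂ + 2 * c₁) * (CV + CD) + (CH + P.d * m * CM) with hC116
  have hK := smoothConst_pos P.d m hc₁ (by positivity : 0 ≤ c₂ + 2 * c₁)
  have hC116_0 : 0 ≤ C116 := by positivity
  have hleG : min δG δ ≤ δG := min_le_left _ _
  have hle : min δG δ ≤ δ := min_le_right _ _
  rw [ineq25At_smooth116_iff]
  refine ⟨fun f f' => ?_, fun f f' => ?_⟩
  · -- clause (i): p33's clause, constants weakened
    have h1 := ((ineq25_delta_iff (hL1 := hL1) (C := C) (Ω := Ω) (Ω₂ := Ω₂) (B := B) (msq := msq) (a := a) (k := k) (K₀ := K₀) (r₀ := r₀)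
      (m := m) (c₁ := c₁) (c₂ := c₂) α δG CG).1 hδG).1 f f'
    have hsd := setDist_nonneg k f.supp f'.supp
    calc normHGHDS C Ω Ω₂ B msq a k α f.fn f'.fn
        ≤ CG * Real.exp (-(δG * (r₀ : ℝ))) * Real.exp (-(δG * setDist k f.supp f'.supp)) := h1
      _ ≤ (CG + C116) * Real.exp (-(min δG δ * (r₀ : ℝ))) * Real.exp (-(min δG δ * setDist k f.supp f'.supp)) :=
          mul_le_mul (mul_le_mul (by linarith) (exp_rate_mono hleG (Nat.cast_nonneg _)) (Real.exp_pos _).le (by positivity))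
            (exp_rate_mono hleG hsd) (Real.exp_pos _).le (by positivity)
  · -- clause (ii): the two-family multiplier on the kernel entries of (1.16)
    have hsd := setDist_nonneg k f.supp f'.supp
    have hdom : DomG k (Interior k K₀ Ω₂) m f.supp := DomG.of_domD f.dom
    have hdom' : DomG k (Interior k K₀ Ω₂) m f'.supp := DomG.of_domD f'.dom
    have hmain := normM2_le_of_entries (C := C) (A := B) (T := op116 C Ω A B msq a k n n') (T' := op116 C Ω A B msq a k n' n)
      (Good := Interior k K₀ Ω₂) (siteInner_op116_adj C Ω A B msq a k n n') hS hα0 hα1 hδ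
      (by positivity : 0 ≤ CV * t) (by positivity : 0 ≤ CD * t) (by positivity : 0 ≤ CH * t) (by positivity : 0 ≤ CM * t) hc₁ hc₂
      hV hV' hDv hDv' hH hH' hM hM' hdom hdom' hsd (fun x hx x' hx' => pow_mul_setDist_le hx hx') f.smooth f'.smooth
    rw [normHGH116S]
    calc _ ≤ (smoothConst P.d m c₁ (c₂ + 2 * c₁) * (CV * t + CD * t) + (CH * t + P.d * m * (CM * t))) *
            Real.exp (-(δ * setDist k f.supp f'.supp)) := hmain
      _ = C116 * t * Real.exp (-(δ * setDist k f.supp f'.supp)) := by rw [hC116]; ring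
      _ ≤ (CG + C116) * t * Real.exp (-(min δG δ * setDist k f.supp f'.supp)) :=
          mul_le_mul (mul_le_mul_of_nonneg_right (by linarith) ht0) (exp_rate_mono hle hsd) (Real.exp_pos _).le (by positivity)


end Main

end Literature.MathematicalPhysics.QuantumFieldTheory.Balaban1983to89.B3Ineq25Op116SmoothInner

end
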